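import Summits.ValiantsHypothesis.ValiantsHypothesis.Theorems.LacunarySymmetroidMatrixDescartesFiniteSectorPairSumMasksShift

/-!
# `MatrixDescartes` — line «stamp»: `n(2,9) = 40` finite core, SLICE(S) (2) of the kernel enumeration (part A)

HONEST FRAMING.  Object-search cell `pub-symmetroid`, seat val-sym-door-p5 g8.  HELPER of the crux item `stmt-ValiantsHypothesis-18050` with NO closure claim and no
statement about pencils: SLICES (third value `a` fixed) of the pruned nested enumeration behind `StampLawAt 2 10 40` (assembled with the T3 transfer in
`…FiniteSectorStampCeilingMTwoTen`), decided in the kernel with pair sums as shift-form bitmasks (`…FiniteSectorPairSumMasksShift`).  The whole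
enumeration has 56788 live prefixes.  Nothing here bears on the crux, the doors, or `VP ≠ VNP`.
[folklore] Finite enumeration (two-stamp postage numbers, OEIS A001212); no citation is load-bearing.
-/

-- `Summit.ValiantsHypothesis.ValiantsHypothesis.…` repeats a component by the D-0017 layout
-- (single-conjunct summit), which the `dupNamespace` linter flags; the name is mandated.
set_option linter.dupNamespace false

namespace Summit.ValiantsHypothesis.ValiantsHypothesis.Theorems.LacunarySymmetroidMatrixDescartes.FiniteSector

set_option synthInstance.maxSize 2000000 in
set_option synthInstance.maxHeartbeats 2000000 in
set_option maxHeartbeats 4000000 in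
/-- **Finite core of `n(2,9) = 40`, slice `(a = 2)`** (34576 live prefixes; pruned nested enumeration over the remaining sorted values
`< 43`, pair sums as shift-form bitmasks, `decide` in the kernel): prefixes covering `[0, next)` by pair sums never cover `[0, 41]`. [folklore] -/
theorem stampCheck_two_ten_s2 :
    ∀ b ∈ List.range 43, (2 < b ∧ (List.foldr (fun x acc => acc ||| (List.foldr (fun y acc => acc ||| 2 ^ y) 0 [0, 1, 2]) * 2 ^ x) 0 [0, 1, 2] % 2 ^ (min 42 b) = 2 ^ (min 42 b) - 1)) →
    ∀ c ∈ List.range 43, (b < c ∧ (List.foldr (fun x acc => acc ||| (List.foldr (fun y acc => acc ||| 2 ^ y) 0 [0, 1, 2, b]) * 2 ^ x) 0 [0, 1, 2, b] % 2 ^ (min 42 c) = 2 ^ (min 42 c) - 1)) →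
    ∀ e ∈ List.range 43, (c < e ∧ (List.foldr (fun x acc => acc ||| (List.foldr (fun y acc => acc ||| 2 ^ y) 0 [0, 1, 2, b, c]) * 2 ^ x) 0 [0, 1, 2, b, c] % 2 ^ (min 42 e) = 2 ^ (min 42 e) - 1)) →
    ∀ f ∈ List.range 43, (e < f ∧ (List.foldr (fun x acc => acc ||| (List.foldr (fun y acc => acc ||| 2 ^ y) 0 [0, 1, 2, b, c, e]) * 2 ^ x) 0 [0, 1, 2, b, c, e] % 2 ^ (min 42 f) = 2 ^ (min 42 f) - 1)) →
    ∀ g ∈ List.range 43, (f < g ∧ (List.foldr (fun x acc => acc ||| (List.foldr (fun y acc => acc ||| 2 ^ y) 0 [0, 1, 2, b, c, e, f]) * 2 ^ x) 0 [0, 1, 2, b, c, e, f] % 2 ^ (min 42 g) = 2 ^ (min 42 g) - 1)) →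
    ∀ k ∈ List.range 43, (g < k ∧ (List.foldr (fun x acc => acc ||| (List.foldr (fun y acc => acc ||| 2 ^ y) 0 [0, 1, 2, b, c, e, f, g]) * 2 ^ x) 0 [0, 1, 2, b, c, e, f, g] % 2 ^ (min 42 k) = 2 ^ (min 42 k) - 1)) →
    ∀ m ∈ List.range 43, (k < m ∧ (List.foldr (fun x acc => acc ||| (List.foldr (fun y acc => acc ||| 2 ^ y) 0 [0, 1, 2, b, c, e, f, g, k]) * 2 ^ x) 0 [0, 1, 2, b, c, e, f, g, k] % 2 ^ (min 42 m) = 2 ^ (min 42 m) - 1)) →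
    ¬ (List.foldr (fun x acc => acc ||| (List.foldr (fun y acc => acc ||| 2 ^ y) 0 [0, 1, 2, b, c, e, f, g, k, m]) * 2 ^ x) 0 [0, 1, 2, b, c, e, f, g, k, m] % 2 ^ 42 = 2 ^ 42 - 1) := by
  decide +kernel

end Summit.ValiantsHypothesis.ValiantsHypothesis.Theorems.LacunarySymmetroidMatrixDescartes.FiniteSector
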